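import Summits.CriticalPhenomena.CardyFormulaZ2.Theorems.CardyUniqueLimitCardyRigidityDefs
import HarnessLib

/-!
# The crossing-probability squeeze under the all-rectangle hypothesis (Camia–Newman (12))

Crux `Summit.CriticalPhenomena.CardyFormulaZ2.Theses.CardyUniqueLimit.CardyRigidity`
(stmt-CriticalPhenomena-0746), line `crossing_martingale`, stub `stub_slitCrossingData`, piece
**(P-soft), measure-theoretic half**.  Camia–Newman (PTRF 139 (2007), proof of Thm 3, eq. (12))
obtain the convergence of crossing probabilities of domains VARYING with the mesh from Cardy's
formula on FIXED Jordan domains by a sandwich of EVENTS: for every `ε` two fixed conformal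
rectangles whose crossing events eventually bracket the given events and whose limiting
crossing probabilities are `ε`-close to the target value.  Here Smirnov's theorem is replaced by
the hypothesis `AllRectangleKernel f` of the crux, and the target value `L` is arbitrary:

* `slitCrossing_tendsto_measureReal_of_sandwich` — if for every `ε > 0` there are conformal
  rectangles `R₁, R₂` with uniformizing data of cross-ratios `η₁, η₂`, `|f ηᵢ - L| ≤ ε`, such
  that eventually `C_δₖ(R₁) ⊆ E_k ⊆ C_δₖ(R₂)` (`discreteCrossing` at positive meshes `δ_k → 0`),
  then `P_{1/2}(E_k) → L`.

The deterministic inclusions are supplied by `…SlitCrossingTransfer.lean`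
(`slitCrossing_discreteCrossing_subset_of_margins`); the flower domains realising them with
`ηᵢ → η` are the remaining (P-soft) input.
-/

noncomputable section

open MeasureTheory Filter Set Topology Metric
open UpperHalfPlane (upperHalfPlaneSet)
open Literature.Probability Literature.Probability.RandomPlanarGeometry
  Literature.Probability.LatticeModels
open Literature.Probability.Percolation (bondDomainCrossingProb BondConfig bondPercolation half
  discreteCrossing bondDomainCrossingProb_eq_measureReal)

namespace Summit.CriticalPhenomena.CardyFormulaZ2.Cruxes.CardyRigidity.CrossingMartingale

/-- Along positive meshes `δ_k → 0` the crossing probabilities of a conformal rectangle converge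
to `f` of the cross-ratio of any uniformizing datum, under `AllRectangleKernel f`. [folklore] -/
theorem Squeeze.tendsto_bondDomainCrossingProb_comp {f : ℝ → ℝ} (hf : AllRectangleKernel f)
    (R : ConformalRectangle) {φ : ConformalEquiv upperHalfPlaneSet R.carrier} {x : Fin 4 → ℝ}
    (hφ : R.IsUniformizing φ x) {δ : ℕ → ℝ} (hδpos : ∀ k, 0 < δ k)
    (hδ : Tendsto δ atTop (𝓝 0)) :
    Tendsto (fun k ↦ bondDomainCrossingProb R (δ k)) atTop (𝓝 (f (crossRatio x))) := by
  have hδ' : Tendsto δ atTop (𝓝[>] 0) :=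
    tendsto_nhdsWithin_iff.2 ⟨hδ, Eventually.of_forall hδpos⟩
  exact (hf R φ x hφ).comp hδ'

/-- **The squeeze (Camia–Newman (12)) under the all-rectangle hypothesis.**  Let `f` satisfy
`AllRectangleKernel f`, let `δ_k > 0`, `δ_k → 0`, and let `E_k` be events of bond percolation on
`ℤ²`.  If for every `ε > 0` there are conformal rectangles `R₁`, `R₂` with uniformizing data
`(φ₁, x₁)`, `(φ₂, x₂)` such that `|f (crossRatio xᵢ) - L| ≤ ε` and, eventually in `k`, the open
crossing event of `(R₁)_{δ_k}` between its arcs `0` and `2` is contained in `E_k` and `E_k` in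
that of `(R₂)_{δ_k}`, then `P_{1/2}(E_k) → L`. [cite: CamiaNewman2007, Thm 3, eq. (12)] -/
theorem slitCrossing_tendsto_measureReal_of_sandwich : ∀ f : ℝ → ℝ, AllRectangleKernel f → ∀ (Ev : ℕ → Set (Literature.Probability.Percolation.BondConfig (Literature.Probability.LatticeModels.Site 2))) (δ : ℕ → ℝ), (∀ k, 0 < δ k) → Filter.Tendsto δ Filter.atTop (nhds 0) → ∀ L : ℝ, (∀ ε : ℝ, 0 < ε → ∃ (R₁ R₂ : Literature.Probability.RandomPlanarGeometry.ConformalRectangle) (φ₁ : Literature.Probability.RandomPlanarGeometry.ConformalEquiv UpperHalfPlane.upperHalfPlaneSet R₁.carrier) (x₁ : Fin 4 → ℝ) (φ₂ : Literature.Probability.RandomPlanarGeometry.ConformalEquiv UpperHalfPlane.upperHalfPlaneSet R₂.carrier) (x₂ : Fin 4 → ℝ), R₁.IsUniformizing φ₁ x₁ ∧ R₂.IsUniformizing φ₂ x₂ ∧ |f (Literature.Probability.RandomPlanarGeometry.crossRatio x₁) - L| ≤ ε ∧ |f (Literature.Probability.RandomPlanarGeometry.crossRatio x₂) - L| ≤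 ε ∧ ∀ᶠ k in Filter.atTop, Literature.Probability.Percolation.discreteCrossing R₁.carrier (δ k) (R₁.arc 0) (R₁.arc 2) ⊆ Ev k ∧ Ev k ⊆ Literature.Probability.Percolation.discreteCrossing R₂.carrier (δ k) (R₂.arc 0) (R₂.arc 2)) → Filter.Tendsto (fun k ↦ (Literature.Probability.Percolation.bondPercolation (Literature.Probability.LatticeModels.zdGraph 2) Literature.Probability.Percolation.half).real (Ev k)) Filter.atTop (nhds L) := by
  intro f hf Ev δ hδpos hδ L h
  rw [Metric.tendsto_atTop]
  intro ε' hε'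
  obtain ⟨R₁, R₂, φ₁, x₁, φ₂, x₂, hφ₁, hφ₂, hL₁, hL₂, hev⟩ := h (ε' / 3) (by positivity)
  have h₁ := Squeeze.tendsto_bondDomainCrossingProb_comp hf R₁ hφ₁ hδpos hδ
  have h₂ := Squeeze.tendsto_bondDomainCrossingProb_comp hf R₂ hφ₂ hδpos hδ
  rw [Metric.tendsto_atTop] at h₁ h₂
  obtain ⟨N₁, hN₁⟩ := h₁ (ε' / 3) (by positivity)
  obtain ⟨N₂, hN₂⟩ := h₂ (ε' / 3) (by positivity)
  obtain ⟨N₃, hN₃⟩ := eventually_atTop.1 hev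
  refine ⟨max N₁ (max N₂ N₃), fun k hk ↦ ?_⟩
  have hk₁ : N₁ ≤ k := le_trans (le_max_left _ _) hk
  have hk₂ : N₂ ≤ k := le_trans ((le_max_left _ _).trans (le_max_right _ _)) hk
  have hk₃ : N₃ ≤ k := le_trans ((le_max_right _ _).trans (le_max_right _ _)) hk
  obtain ⟨hsub₁, hsub₂⟩ := hN₃ k hk₃
  have hlow : bondDomainCrossingProb R₁ (δ k) ≤ (bondPercolation (zdGraph 2) half).real (Ev k) := by
    rw [bondDomainCrossingProb_eq_measureReal]
    exact measureReal_mono hsub₁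
  have hup : (bondPercolation (zdGraph 2) half).real (Ev k) ≤ bondDomainCrossingProb R₂ (δ k) := by
    rw [bondDomainCrossingProb_eq_measureReal]
    exact measureReal_mono hsub₂
  have e₁ := hN₁ k hk₁
  have e₂ := hN₂ k hk₂
  rw [Real.dist_eq] at e₁ e₂ ⊢
  rw [abs_sub_lt_iff] at e₁ e₂ ⊢
  obtain ⟨hL₁a, hL₁b⟩ := abs_sub_le_iff.1 hL₁
  obtain ⟨hL₂a, hL₂b⟩ := abs_sub_le_iff.1 hL₂
  constructor <;> linarith [e₁.1, e₁.2, e₂.1, e₂.2]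

end Summit.CriticalPhenomena.CardyFormulaZ2.Cruxes.CardyRigidity.CrossingMartingale

end
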